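import Mathlib
import Summits.AtomisticToContinuum.Crystallization.Theses.PhononSlackCertificates
import Summits.AtomisticToContinuum.Crystallization.Theorems.PhononSlackCertificatesNearFarGlueRHoles
import Literature.MathematicalPhysics.StatisticalMechanics.LennardJonesClusters

/-!
# Crux `PhononSlackCertificates.NearFarGlueR` (stmt-AtomisticToContinuum-14970), line `Sketch`:
the assembly principle for `k` congruent copies

Continuation lead c5.  Companion of `Theorems/PhononSlackCertificatesNearFarGlueRAssembly.lean`
(two copies): for every finite injective configuration `x` of `ℝ³` and every family
`σ_0, …, σ_{k−1}` of distance-preserving maps whose copies `σ_a(x)` are pairwise disjoint,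

  `k·N·e* ≤ k·𝓔_LJ(x) + ½·Σ_a Σ_{b ≠ a} Σ_i Σ_j V(|σ_a x_i − σ_b x_j|)`

(`assembly_principle_family` = registered sub-goal `stub_assemblyFamily`): periodisation
(`card_mul_eStar_le`) of the assembled configuration indexed by `Fin k × Fin N`, whose energy is
`k` copies of `𝓔(x)` plus the cross terms.  Dividing by `k`: the excess energy of `x` is at
least `−(1/k)·(total cross energy of any k-copy assembly)`; finite blocks of the reflection group
of a box, chains of alternating mirrors, corner assemblies (three perpendicular mirrors, `k = 8`)
are instances.  No cone on `e*` is used.  All `[folklore]`.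
-/

noncomputable section

namespace Summit.AtomisticToContinuum.Crystallization.Theorems.PhononSlackCertificatesNearFarGlueR

open Literature.MathematicalPhysics.StatisticalMechanics
open Literature.Geometry.DiscreteGeometry
open Summit.AtomisticToContinuum.Crystallization.Theses.PhononSlackCertificates
open Summit.AtomisticToContinuum.Crystallization.Theorems.ChargedEnergyGapNegative
  (eStar card_mul_eStar_le)
open scoped BigOperators

/-- **Assembly principle, `k` copies.**  For a finite injective configuration `x` of `ℝ³` and
distance-preserving maps `σ_a` (`a < k`) with pairwise disjoint copies,
`k·N·e* ≤ k·𝓔_LJ(x) + ½·Σ_a Σ_{b≠a} Σ_i Σ_j V(|σ_a x_i − σ_b x_j|)`. [folklore] -/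
theorem assembly_principle_family {N k : ℕ} (x : Fin N → EuclideanSpace ℝ (Fin 3))
    (hx : Function.Injective x)
    (σ : Fin k → EuclideanSpace ℝ (Fin 3) → EuclideanSpace ℝ (Fin 3))
    (hσ : ∀ (a : Fin k) (p q : EuclideanSpace ℝ (Fin 3)), dist (σ a p) (σ a q) = dist p q)
    (hoff : ∀ (a b : Fin k), a ≠ b → ∀ (i j : Fin N), σ a (x i) ≠ σ b (x j)) :
    ((k * N : ℕ) : ℝ) * (⨅ Q : PeriodicConfiguration 3, Q.energyPerParticle lennardJones) ≤
      (k : ℝ) * interactionEnergy lennardJones x +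
        (1 / 2 : ℝ) * ∑ a : Fin k, ∑ b ∈ Finset.univ.erase a, ∑ i : Fin N, ∑ j : Fin N,
          lennardJones (dist (σ a (x i)) (σ b (x j))) := by
  -- the assembled configuration
  set Y : Fin k × Fin N → EuclideanSpace ℝ (Fin 3) := fun p => σ p.1 (x p.2) with hY
  set X : Fin (k * N) → EuclideanSpace ℝ (Fin 3) := Y ∘ finProdFinEquiv.symm with hX
  have hYinj : Function.Injective Y := by
    rintro ⟨a, i⟩ ⟨b, j⟩ h
    by_cases hab : a = b
    · subst hab
      have h0 : dist (σ a (x i)) (σ a (x j)) = 0 := dist_eq_zero.2 h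
      rw [hσ] at h0
      exact Prod.ext rfl (hx (dist_eq_zero.1 h0))
    · exact absurd h (hoff a b hab i j)
  have hXinj : Function.Injective X := hYinj.comp finProdFinEquiv.symm.injective
  have hE := card_mul_eStar_le hXinj
  change ((k * N : ℕ) : ℝ) * (⨅ Q : PeriodicConfiguration 3, Q.energyPerParticle lennardJones) ≤
    interactionEnergy lennardJones X at hE
  -- energy of the assembly as a double sum over `Fin k × Fin N`
  have h2 := two_mul_interactionEnergy_eq_sum_sum lennardJones lennardJones_zero X
  have hre : ∑ m, ∑ m', lennardJones (dist (X m) (X m')) =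
      ∑ p : Fin k × Fin N, ∑ q : Fin k × Fin N, lennardJones (dist (Y p) (Y q)) := by
    simp only [hX, Function.comp_apply]
    exact (finProdFinEquiv.symm.sum_comp (fun p => ∑ m' : Fin (k * N),
      lennardJones (dist (Y p) (Y (finProdFinEquiv.symm m'))))).trans
      (Finset.sum_congr rfl fun p _ => finProdFinEquiv.symm.sum_comp
        (fun q => lennardJones (dist (Y p) (Y q))))
  have h2x := two_mul_interactionEnergy_eq_sum_sum lennardJones lennardJones_zero x
  -- each row `(a, i)`: own copy + other copies
  have hrow : ∀ (a : Fin k) (i : Fin N),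
      ∑ q : Fin k × Fin N, lennardJones (dist (Y (a, i)) (Y q)) =
        ∑ j, lennardJones (dist (x i) (x j)) +
          ∑ b ∈ Finset.univ.erase a, ∑ j, lennardJones (dist (σ a (x i)) (σ b (x j))) := by
    intro a i
    rw [Fintype.sum_prod_type, ← Finset.add_sum_erase _ _ (Finset.mem_univ a)]
    simp only [hY, hσ]
  have hsum : ∑ p : Fin k × Fin N, ∑ q : Fin k × Fin N, lennardJones (dist (Y p) (Y q)) =
      (k : ℝ) * ∑ i, ∑ j, lennardJones (dist (x i) (x j)) +
        ∑ a : Fin k, ∑ b ∈ Finset.univ.erase a, ∑ i : Fin N, ∑ j : Fin N,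
          lennardJones (dist (σ a (x i)) (σ b (x j))) := by
    rw [Fintype.sum_prod_type]
    simp only [hrow, Finset.sum_add_distrib, Finset.sum_const, Finset.card_univ,
      Fintype.card_fin, nsmul_eq_mul]
    congr 1
    exact Finset.sum_congr rfl fun a _ => Finset.sum_comm
  have hEX : 2 * interactionEnergy lennardJones X =
      (k : ℝ) * (2 * interactionEnergy lennardJones x) +
        ∑ a : Fin k, ∑ b ∈ Finset.univ.erase a, ∑ i : Fin N, ∑ j : Fin N,
          lennardJones (dist (σ a (x i)) (σ b (x j))) := by
    rw [h2, hre, hsum, h2x]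
  linarith

/-- **Registered sub-goal `stub_assemblyFamily` of the line `Sketch`.** [folklore] -/
theorem stub_assemblyFamily :
    ∀ (N k : ℕ) (x : Fin N → EuclideanSpace ℝ (Fin 3)), Function.Injective x →
    ∀ (σ : Fin k → EuclideanSpace ℝ (Fin 3) → EuclideanSpace ℝ (Fin 3)),
      (∀ (a : Fin k) (p q : EuclideanSpace ℝ (Fin 3)), dist (σ a p) (σ a q) = dist p q) →
      (∀ (a b : Fin k), a ≠ b → ∀ (i j : Fin N), σ a (x i) ≠ σ b (x j)) →
      ((k * N : ℕ) : ℝ) * (⨅ Q : PeriodicConfiguration 3, Q.energyPerParticle lennardJones) ≤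
        (k : ℝ) * interactionEnergy lennardJones x +
          (1 / 2 : ℝ) * ∑ a : Fin k, ∑ b ∈ Finset.univ.erase a, ∑ i : Fin N, ∑ j : Fin N,
            lennardJones (dist (σ a (x i)) (σ b (x j))) :=
  fun _ _ x hx σ hσ hoff => assembly_principle_family x hx σ hσ hoff

end Summit.AtomisticToContinuum.Crystallization.Theorems.PhononSlackCertificatesNearFarGlueR

end
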